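import Mathlib.Probability.Independence.InfinitePi
import Mathlib.Probability.StrongLaw
import Mathlib.MeasureTheory.Constructions.Polish.Basic
import Literature.Probability.Exchangeability.DeFinettiProduct
import HarnessLib

/-!
# de Finetti's theorem (de Finetti, Hewitt–Savage, Ryll-Nardzewski)

**Theorem** (Kallenberg, *Foundations of Modern Probability* (2nd ed.), Thm 11.10, for the
implication (i) ⇒ (iii) in its unconditional form together with the identification of the
directing measure).  Let `E` be a standard Borel space and `P` an exchangeable probability law
on `ℕ → E`.  Then, with `ν = directingKernel P` (a Markov kernel `(ℕ → E) → E`, a version of the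
conditional law of `x 0` given the exchangeable σ-algebra):

* `IsExchangeable.measure_eq_lintegral_infinitePi` — **`P` is a mixture of i.i.d. laws directed
  by `ν`**: `P S = ∫ (ν_x)^{⊗ℕ} (S) P(dx)` for every measurable `S`, i.e.
  `P = P.bind (iidKernel ν)` (`eq_bind_iidKernel`);
* (`DeFinettiProduct.lean`) `IsExchangeable.measure_pi_eq_lintegral_prod` — on boxes:
  `P {x | ∀ i < k, x i ∈ t i} = ∫ ∏_{i<k} ν_x (t i) P(dx)`;
* `IsExchangeable.ae_tendsto_empirical` — **`ν` is the a.s. limit of the empirical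
  distributions**: `n⁻¹ ∑_{i<n} 𝟙_B (x i) → ν_x (B)` for `P`-a.e. `x`, every measurable `B`
  (hence `ν` is a.s. unique);
* `isExchangeable_bind_iidKernel`, `isExchangeable_iff_exists_eq_bind_iidKernel` — the converse
  (mixtures of i.i.d. laws are exchangeable) and the equivalence (i) ⇔ (iii) of Thm 11.10;
* `deFinetti` — the statements packaged as an existence statement.

Proof (an `L²`/block-sampling rendering of Kallenberg's proof via Lemma 11.9): by
exchangeability `E ∏_{i<k} f_i (x i) = E ∏_{i<k} blockAvg (B_i) f_i` for the disjoint
arithmetic-progression blocks `B_i = {i + k j : j < n}` (every index tuple is injective), and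
the right side tends to `E ∏_i limAvg f_i = E ∏_i ∫ f_i dν` (`LimitStatistic.lean`); the
box formula follows, then the mixture formula by a `π`-system argument, and the empirical
limit by the strong law of large numbers under each `(ν_x)^{⊗ℕ}`.

## References

* O. Kallenberg, *Foundations of Modern Probability*, 2nd ed., Springer 2002, Thm 11.10.
  [Kallenberg2002]
* B. de Finetti, *La prévision : ses lois logiques, ses sources subjectives*, Ann. Inst.
  H. Poincaré 7 (1937) 1–68; E. Hewitt, L. J. Savage, *Symmetric measures on Cartesian
  products*, Trans. AMS 80 (1955) 470–501 (historical).
-/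

namespace Literature.Probability.Exchangeability

open _root_.MeasureTheory _root_.ProbabilityTheory Equiv Function Set Finset Filter
open scoped Topology ENNReal

variable {E : Type*} [MeasurableSpace E]

/-! ### The mixture formula -/

namespace IsExchangeable

variable {P : Measure (ℕ → E)} [IsProbabilityMeasure P] [StandardBorelSpace E]

/-- **de Finetti's theorem, mixture form**: an exchangeable probability law on `ℕ → E`
(`E` standard Borel) is the mixture of the i.i.d. laws `(ν_x)^{⊗ℕ}` directed by its directing
kernel: `P = P.bind (iidKernel (directingKernel P))`. [cite: Kallenberg2002, Thm 11.10] -/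
theorem eq_bind_iidKernel (h : IsExchangeable P) :
    P = P.bind (iidKernel (directingKernel P)) := by
  classical
  set ν := directingKernel P with hν
  have hbind : ∀ S, MeasurableSet S →
      P.bind (iidKernel ν) S = ∫⁻ x, Measure.infinitePi (fun _ : ℕ => ν x) S ∂P := fun S hS =>
    Measure.bind_apply hS (iidKernel ν).measurable.aemeasurable
  haveI : IsProbabilityMeasure (P.bind (iidKernel ν)) :=
    ⟨by rw [hbind _ MeasurableSet.univ]; simp⟩
  refine ext_of_generate_finite _ generateFrom_squareCylinders.symm
    (isPiSystem_squareCylinders (fun _ => MeasurableSpace.isPiSystem_measurableSet)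
      fun _ => MeasurableSet.univ) ?_ (by simp)
  rintro _ ⟨s, t, ht, rfl⟩
  simp only [Set.mem_univ_pi, Set.mem_setOf_eq] at ht
  rw [hbind _ (MeasurableSet.pi s.countable_toSet fun i _ => ht i)]
  simp_rw [Measure.infinitePi_pi _ fun i _ => ht i]
  -- express the square cylinder as a box over `Fin k`
  set k := s.sup id + 1 with hk
  have hsk : ∀ i ∈ s, i < k := fun i hi => Nat.lt_succ_of_le (Finset.le_sup (f := id) hi)
  set t' : Fin k → Set E := fun i => if (i : ℕ) ∈ s then t i else Set.univ with ht'
  have ht'm : ∀ i, MeasurableSet (t' i) := fun i => by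
    simp only [ht']; split_ifs
    · exact ht _
    · exact MeasurableSet.univ
  have hset : (s : Set ℕ).pi t = {x : ℕ → E | ∀ i : Fin k, x i ∈ t' i} := by
    ext x
    simp only [Set.mem_pi, Finset.mem_coe, Set.mem_setOf_eq, ht']
    constructor
    · intro hx i
      split_ifs with hi
      · exact hx _ hi
      · exact Set.mem_univ _
    · intro hx i hi
      have := hx ⟨i, hsk i hi⟩
      simpa [hi] using this
  rw [hset, h.measure_pi_eq_lintegral_prod t' ht'm]
  refine lintegral_congr fun x => ?_
  have hprod : ∏ i : Fin k, ν x (t' i) = ∏ i ∈ Finset.range k, if i ∈ s then ν x (t i) else 1 := by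
    rw [← Fin.prod_univ_eq_prod_range (fun i => if i ∈ s then ν x (t i) else 1) k]
    refine Finset.prod_congr rfl fun i _ => ?_
    simp only [ht']
    split_ifs <;> simp
  rw [hprod, Finset.prod_ite_mem, Finset.inter_eq_right.mpr fun i hi => Finset.mem_range.mpr (hsk i hi)]

/-- **de Finetti's theorem, mixture form** on sets: `P S = ∫ (ν_x)^{⊗ℕ} (S) P(dx)` for every
measurable `S ⊆ (ℕ → E)`, `ν = directingKernel P`. [cite: Kallenberg2002, Thm 11.10] -/
theorem measure_eq_lintegral_infinitePi (h : IsExchangeable P) {S : Set (ℕ → E)}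
    (hS : MeasurableSet S) :
    P S = ∫⁻ x, Measure.infinitePi (fun _ : ℕ => directingKernel P x) S ∂P := by
  conv_lhs => rw [h.eq_bind_iidKernel]
  rw [Measure.bind_apply hS (iidKernel (directingKernel P)).measurable.aemeasurable]
  rfl

/-- **The directing measure is the a.s. limit of the empirical distributions**:
`n⁻¹ ∑_{i<n} 𝟙_B (x i) → ν_x (B)` for `P`-a.e. `x` (strong law under each `(ν_x)^{⊗ℕ}`,
mixed by the mixture formula; the limit is identified through the subsequence `n = 4^m`).
In particular the directing kernel is `P`-a.s. unique. [cite: Kallenberg2002, Thm 11.10] -/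
theorem ae_tendsto_empirical (h : IsExchangeable P) {B : Set E} (hB : MeasurableSet B) :
    ∀ᵐ x ∂P, Tendsto (fun n : ℕ => (n : ℝ)⁻¹ * ∑ i ∈ Finset.range n, B.indicator (1 : E → ℝ) (x i))
      atTop (𝓝 ((directingKernel P x).real B)) := by
  set g : E → ℝ := B.indicator 1 with hg
  have hgm : Measurable g := measurable_one.indicator hB
  have hg1 : ∀ z, |g z| ≤ 1 := fun z => by by_cases hz : z ∈ B <;> simp [hg, hz]
  -- the convergence set
  set Conv := {y : ℕ → E | ∃ c : ℝ,
    Tendsto (fun n : ℕ => (n : ℝ)⁻¹ * ∑ i ∈ Finset.range n, g (y i)) atTop (𝓝 c)} with hConv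
  have hmeas_avg : ∀ n : ℕ, Measurable fun y : ℕ → E => (n : ℝ)⁻¹ * ∑ i ∈ Finset.range n, g (y i) :=
    fun n => measurable_const.mul (Finset.measurable_sum _ fun i _ => hgm.comp (measurable_pi_apply i))
  have hConvm : MeasurableSet Conv := measurableSet_exists_tendsto hmeas_avg
  -- under each (directingKernel P x)^⊗ℕ the averages converge a.s. (SLLN)
  have hK : ∀ x : ℕ → E, Measure.infinitePi (fun _ : ℕ => directingKernel P x) Conv = 1 := by
    intro x
    set μ := Measure.infinitePi (fun _ : ℕ => directingKernel P x) with hμ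
    have hind : iIndepFun (fun (i : ℕ) (y : ℕ → E) => g (y i)) μ :=
      iIndepFun_infinitePi (P := fun _ : ℕ => directingKernel P x) (X := fun _ => g) fun _ => hgm
    have hid : ∀ i, IdentDistrib (fun y : ℕ → E => g (y i)) (fun y : ℕ → E => g (y 0)) μ μ := by
      intro i
      have h0 : IdentDistrib (fun y : ℕ → E => y i) (fun y : ℕ → E => y 0) μ μ :=
        ⟨(measurable_pi_apply i).aemeasurable, (measurable_pi_apply 0).aemeasurable, by
          rw [hμ, Measure.infinitePi_map_eval, Measure.infinitePi_map_eval]⟩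
      exact h0.comp hgm
    have hint : Integrable (fun y : ℕ → E => g (y 0)) μ :=
      integrable_of_abs_le (hgm.comp (measurable_pi_apply 0)) fun y => hg1 (y 0)
    have hslln := strong_law_ae (μ := μ) (fun (i : ℕ) (y : ℕ → E) => g (y i)) hint
      (fun i j hij => hind.indepFun hij) hid
    have hae : ∀ᵐ y ∂μ, y ∈ Conv := by
      filter_upwards [hslln] with y hy
      exact ⟨_, by simpa [smul_eq_mul] using hy⟩
    have hc0 : μ Convᶜ = 0 := ae_iff.mp hae
    exact (prob_compl_eq_zero_iff hConvm).mp hc0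
  -- hence P-a.s. the averages converge
  have hPConv : ∀ᵐ x ∂P, x ∈ Conv := by
    have h1 : P Conv = 1 := by
      rw [h.measure_eq_lintegral_infinitePi hConvm]
      simp_rw [hK]
      simp
    have h2 : P Convᶜ = 0 := (prob_compl_eq_zero_iff hConvm).mpr h1
    rw [ae_iff]
    exact h2
  -- identify the limit through the subsequence 4^m
  filter_upwards [hPConv, h.ae_tendsto_blockAvg hgm hg1, h.directingKernel_real_ae_eq_limAvg hB]
    with x hx hx4 hxν
  obtain ⟨c, hc⟩ := hx
  have hsub : Tendsto (fun m : ℕ => ((4 ^ m : ℕ) : ℝ)⁻¹ * ∑ i ∈ Finset.range (4 ^ m), g (x i))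
      atTop (𝓝 c) :=
    hc.comp (tendsto_pow_atTop_atTop_of_one_lt (by norm_num))
  have hx4' : Tendsto (fun m : ℕ => ((4 ^ m : ℕ) : ℝ)⁻¹ * ∑ i ∈ Finset.range (4 ^ m), g (x i))
      atTop (𝓝 (limAvg g x)) := by
    simpa [blockAvg_def, Finset.card_range] using hx4
  have hc_eq : c = limAvg g x := tendsto_nhds_unique hsub hx4'
  rw [hxν, ← hc_eq]
  exact hc

end IsExchangeable


/-! ### The converse: mixtures of i.i.d. laws are exchangeable -/

/-- **Product laws are exchangeable**: `m^{⊗ℕ}` is invariant under every coordinate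
permutation. [cite: Kallenberg2002, Thm 11.10 ((iii) ⇒ (i))] -/
theorem isExchangeable_infinitePi (m : Measure E) [IsProbabilityMeasure m] :
    IsExchangeable (Measure.infinitePi fun _ : ℕ => m) := by
  classical
  refine IsExchangeable.of_swap fun a b => ?_
  apply Measure.eq_infinitePi
  intro s t ht
  rw [Measure.map_apply (measurable_comp_right _)
    (MeasurableSet.pi s.countable_toSet fun i _ => ht i)]
  have hpre : (fun x : ℕ → E => x ∘ swap a b) ⁻¹' (s : Set ℕ).pi t =
      ((s.image (swap a b) : Finset ℕ) : Set ℕ).pi (fun j => t (swap a b j)) := by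
    ext x
    simp only [Set.mem_preimage, Set.mem_pi, Finset.mem_coe, Finset.mem_image, comp_apply]
    constructor
    · rintro hx j ⟨i, hi, rfl⟩
      rw [swap_apply_self]
      exact hx i hi
    · intro hx i hi
      have := hx (swap a b i) ⟨i, hi, rfl⟩
      rwa [swap_apply_self] at this
  rw [hpre, Measure.infinitePi_pi _ (fun j _ => ht _),
    Finset.prod_image fun i _ j _ h => (swap a b).injective h]
  refine Finset.prod_congr rfl fun i _ => ?_
  rw [swap_apply_self]

/-- **Mixtures of i.i.d. laws are exchangeable**: for any measure `Q` on a parameter space and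
any Markov kernel `ν`, the mixture `Q.bind (iidKernel ν) = ∫ (ν a)^{⊗ℕ} Q(da)` is exchangeable
(Kallenberg, Thm 11.10, the easy implication (iii) ⇒ (i)). [cite: Kallenberg2002, Thm 11.10] -/
theorem isExchangeable_bind_iidKernel {α : Type*} [MeasurableSpace α] (Q : Measure α)
    (ν : Kernel α E) [IsMarkovKernel ν] : IsExchangeable (Q.bind (iidKernel ν)) := by
  intro σ hσ
  ext S hS
  rw [Measure.map_apply (measurable_comp_right σ) hS,
    Measure.bind_apply hS (iidKernel ν).measurable.aemeasurable,
    Measure.bind_apply (measurable_comp_right σ hS) (iidKernel ν).measurable.aemeasurable]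
  refine lintegral_congr fun a => ?_
  rw [iidKernel_apply, ← Measure.map_apply (measurable_comp_right σ) hS,
    isExchangeable_infinitePi (ν a) σ hσ]

/-- **de Finetti's theorem as an equivalence** (Kallenberg, Thm 11.10, (i) ⇔ (iii) in mixture
form): a probability law on `ℕ → E`, `E` standard Borel, is exchangeable iff it is a mixture
`P = P.bind (iidKernel ν)` of i.i.d. laws directed by some Markov kernel `ν` on the same space.
[cite: Kallenberg2002, Thm 11.10] -/
theorem isExchangeable_iff_exists_eq_bind_iidKernel [StandardBorelSpace E] {P : Measure (ℕ → E)}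
    [IsProbabilityMeasure P] :
    IsExchangeable P ↔
      ∃ (ν : Kernel (ℕ → E) E) (_ : IsMarkovKernel ν), P = P.bind (iidKernel ν) := by
  constructor
  · exact fun h => ⟨directingKernel P, inferInstance, h.eq_bind_iidKernel⟩
  · rintro ⟨ν, hν, hP⟩
    rw [hP]
    exact isExchangeable_bind_iidKernel P ν

/-- **de Finetti's theorem** (de Finetti; Hewitt–Savage; Ryll-Nardzewski — Kallenberg,
*Foundations of Modern Probability*, Thm 11.10): an exchangeable probability law `P` on
`ℕ → E`, `E` a standard Borel space, is a mixture of i.i.d. laws: there is a Markov kernel `ν`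
from `ℕ → E` to `E` (the directing random measure, a.s. the limit of the empirical
distributions, hence a.s. unique) with `P = ∫ (ν_x)^{⊗ℕ} P(dx)`.
[cite: Kallenberg2002, Thm 11.10] -/
theorem deFinetti [StandardBorelSpace E] (P : Measure (ℕ → E)) [IsProbabilityMeasure P]
    (h : IsExchangeable P) :
    ∃ ν : Kernel (ℕ → E) E, IsMarkovKernel ν ∧
      (∀ S : Set (ℕ → E), MeasurableSet S →
        P S = ∫⁻ x, Measure.infinitePi (fun _ : ℕ => ν x) S ∂P) ∧
      (∀ B : Set E, MeasurableSet B → ∀ᵐ x ∂P,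
        Tendsto (fun n : ℕ => (n : ℝ)⁻¹ * ∑ i ∈ Finset.range n, B.indicator (1 : E → ℝ) (x i))
          atTop (𝓝 ((ν x).real B))) :=
  ⟨directingKernel P, inferInstance, fun _ hS => h.measure_eq_lintegral_infinitePi hS,
    fun _ hB => h.ae_tendsto_empirical hB⟩

end Literature.Probability.Exchangeability
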